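import Literature.NumberTheory.Automorphic.CompactCoreCentralizerDiagonalTranslation   -- ★ p843402 A-p06 (g27): `valuation_apply_eq_one_of_mem_of_isCompact_of_le_centralizer_diagonal`
import HarnessLib

/-!
# A regular diagonal element with a non-unit eigenvalue fixes NO coset of a compact subgroup: `|φ(γ)ᵢᵢ| ≠ 1 ⇒ Fix_γ(G ⧸ K) = ∅`
(Serre (1980), *Trees* II.1.1–1.3: a hyperbolic element of the split torus of `SL₂` over a local field fixes no vertex and no edge of the tree;
Tits (1979) §3.9; Kottwitz (1988) §2: the hyperbolic orbital integrals of the Euler–Poincaré function are sums over fixed facets PER PERIOD)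

Topic `NumberTheory/Automorphic`; namespace `Literature.NumberTheory.Automorphic`.  KERNEL mathematics only: theorems, no definition, no named fact, no instance, no
notation, no `sorry`.  Cell `pub/hodgecm-mathlib`, F0∕P3a, crux H413 = `stmt-HodgeConjecture-24833`, line «N6nsGerm», stub `stub_N6nsR2EP : RankOneEulerPoincareNonsplit`,
RAMIFIED half (census `F0/P3a/A-p06/g27/CENSUS-R2ram-….md`, plan step (S3) of A-p06 (g27), 09:43:30Z; seat F0P3a-p04 (g13)).  SETTING = the engine of ★ p843402
`CompactCoreCentralizerDiagonalTranslation` (A-p06): an abstract group `G` with a CLOSED EMBEDDING `φ : G →* GL_N(E_w)` and `γ ∈ G` whose image is a REGULAR DIAGONAL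
`diagonal d` (`dᵢ − dⱼ` units for `i ≠ j`); there (gen)∕(free) read the split torus `Z_G(γ) = τ^ℤ · compactCore` through the valuations `|φ(·)ᵢᵢ|`; HERE the complementary
case of the per-period count ★ p842951 ∕ p843359 `classOrbitalIntegral_indicator_eq_mul_natCard_quotient_zpowers`: if SOME `|φ(γ)ᵢᵢ| ≠ 1` then `γ` lies in no compact
subgroup of `G`, so it fixes no coset of any compact subgroup `K` and every per-period count `#(Fix_γ(G ⧸ K) ∕ R)` is `0` — the non-elliptic relation (N) of Kottwitz's
Euler–Poincaré function then reads `0 + 0 − 0 = 0` for the three facet stabilisers `K, K♯, I` alike.  HONEST LABEL: HC_CM is proved only modulo the printed citations until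
rung 0 closes; nothing printed is asserted here.

THE MATHEMATICS.  If `x⁻¹ γ x ∈ K` with `K` compact then `γ ∈ x K x⁻¹`; the subgroup `C := x K x⁻¹ ⊓ Z_G(γ)` is compact (`Z_G(γ)` is closed, `G` is T₂ through `φ`), contains
`γ`, and `φ(C)` is a compact subgroup of `GL_N(E_w)` centralising `φ γ = diagonal d`; by ★ `valuation_apply_eq_one_of_mem_of_isCompact_of_le_centralizer_diagonal` all its
diagonal entries are units — in particular `|φ(γ)ᵢᵢ| = 1` for every `i`.  Contrapositive: `|φ(γ)ᵢᵢ| ≠ 1` for some `i` ⇒ `x⁻¹ γ x ∉ K` for all `x` ⇒ `Fix_γ(G ⧸ K) = ∅`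
(`γ • xK = xK ↔ x⁻¹ γ x ∈ K`) ⇒ `Nat.card` of any quotient of `Fix_γ(G ⧸ K)` is `0`.

* `valuation_apply_eq_one_of_conj_mem` — `x⁻¹ γ x ∈ K`, `K` compact ⇒ `|φ(γ)ᵢᵢ| = 1` for all `i`.
* `forall_conj_notMem_of_valuation_apply_ne_one` — `|φ(γ)ᵢᵢ| ≠ 1` ⇒ `∀ x, x⁻¹ γ x ∉ K`.
* `fixedBy_quotient_eq_empty_of_valuation_apply_ne_one` — `… ⇒ MulAction.fixedBy (G ⧸ K) γ = ∅`.
* `natCard_quotient_fixedBy_eq_zero_of_valuation_apply_ne_one` — `… ⇒ Nat.card (Quotient (R.comap Subtype.val)) = 0` for every setoid `R` on `G ⧸ K`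
  (the per-period reading of ★ p843359 with `R = orbitRel (zpowers τ)`).

## References
* [Serre1980Trees] J.-P. Serre, *Trees* (1980), Ch. II §1.1–§1.3 (the tree of `SL₂`; hyperbolic elements have no fixed vertex).
* [Tits1979] J. Tits, *Reductive groups over local fields*, PSPM 33.1 (1979), §3.9.
* [Kottwitz1988] R. E. Kottwitz, *Tamagawa numbers*, Ann. of Math. 127 (1988), §2 (orbital integrals of Euler–Poincaré functions).
-/

set_option autoImplicit false

noncomputable section

open Matrix NumberField IsDedekindDomain Topology
open scoped MatrixGroups ValuativeRel
open ValuativeRel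

namespace Literature.NumberTheory.Automorphic

open Literature.NumberTheory.GaloisRepresentations

variable {E : Type} [Field E] [NumberField E] (w : HeightOneSpectrum (𝓞 E)) {N : ℕ}
  {G : Type*} [Group G] [TopologicalSpace G] [IsTopologicalGroup G] (φ : G →* GL (Fin N) (w.adicCompletion E)) {γ : G} {d : Fin N → w.adicCompletion E}
  (hγ : ((φ γ : GL (Fin N) (w.adicCompletion E)) : Matrix (Fin N) (Fin N) (w.adicCompletion E)) = diagonal d) (hd : ∀ i j, i ≠ j → IsUnit (d i - d j))

include hγ hd in
/-- **A conjugate of the regular diagonal `γ` inside a compact subgroup forces unit eigenvalues**: if `x⁻¹ γ x ∈ K` with `K ≤ G` compact (and `φ` a closed embedding), then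
`|φ(γ)ᵢᵢ|_w = 1` for every `i` — `φ(x K x⁻¹ ⊓ Z_G(γ))` is a compact subgroup of `GL_N(E_w)` centralising `φ γ` and containing it (★
`valuation_apply_eq_one_of_mem_of_isCompact_of_le_centralizer_diagonal`). [cite: Tits1979, §3.9] [cite: Serre1980Trees, Ch. II §1.3] -/
theorem valuation_apply_eq_one_of_conj_mem (hφ : IsClosedEmbedding φ) (K : Subgroup G) (hKc : IsCompact (K : Set G)) {x : G} (hx : x⁻¹ * γ * x ∈ K)
    (i : Fin N) :
    valuation (w.adicCompletion E) (((φ γ : GL (Fin N) (w.adicCompletion E)) : Matrix (Fin N) (Fin N) (w.adicCompletion E)) i i) = 1 := by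
  haveI : T2Space G := hφ.isEmbedding.t2Space
  -- the compact subgroup `x K x⁻¹ ⊓ Z_G(γ)` contains `γ`
  set C : Subgroup G := K.map (MulAut.conj x).toMonoidHom ⊓ Subgroup.centralizer ({γ} : Set G) with hCdef
  have hγC : γ ∈ C := by
    refine ⟨⟨x⁻¹ * γ * x, hx, ?_⟩, Subgroup.mem_centralizer_singleton_iff.2 rfl⟩
    simp only [MulEquiv.coe_toMonoidHom, MulAut.conj_apply]; group
  have hCc : IsCompact (C : Set G) := by
    have h1 : IsCompact ((K.map (MulAut.conj x).toMonoidHom : Subgroup G) : Set G) := by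
      rw [Subgroup.coe_map]
      refine hKc.image ?_
      change Continuous fun g : G => (MulAut.conj x) g
      simp only [MulAut.conj_apply]
      exact (continuous_const.mul continuous_id).mul continuous_const
    rw [hCdef, Subgroup.coe_inf]
    exact h1.inter_right (Set.isClosed_centralizer _)
  -- its image under `φ`
  have hφCc : IsCompact ((C.map φ : Subgroup (GL (Fin N) (w.adicCompletion E))) : Set (GL (Fin N) (w.adicCompletion E))) := by
    rw [Subgroup.coe_map]; exact hCc.image hφ.continuous
  have hφCZ : (C.map φ : Subgroup (GL (Fin N) (w.adicCompletion E))) ≤ Subgroup.centralizer ({φ γ} : Set (GL (Fin N) (w.adicCompletion E))) := by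
    rintro _ ⟨z, hz, rfl⟩
    exact apply_mem_centralizer_of_mem_centralizer φ γ hz.2
  exact valuation_apply_eq_one_of_mem_of_isCompact_of_le_centralizer_diagonal N w hγ hd _ hφCc hφCZ ⟨γ, hγC, rfl⟩ i

include hγ hd in
/-- **`|φ(γ)ᵢᵢ| ≠ 1` for some `i` ⇒ NO conjugate of `γ` lies in the compact subgroup `K`.** [cite: Serre1980Trees, Ch. II §1.3] [cite: Tits1979, §3.9] -/
theorem forall_conj_notMem_of_valuation_apply_ne_one (hφ : IsClosedEmbedding φ) (K : Subgroup G) (hKc : IsCompact (K : Set G)) {i : Fin N}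
    (hγi : valuation (w.adicCompletion E) (((φ γ : GL (Fin N) (w.adicCompletion E)) : Matrix (Fin N) (Fin N) (w.adicCompletion E)) i i) ≠ 1) :
    ∀ x : G, x⁻¹ * γ * x ∉ K :=
  fun _ hx => hγi (valuation_apply_eq_one_of_conj_mem w φ hγ hd hφ K hKc hx i)

/-- `γ • xK = xK ↔ x⁻¹ γ x ∈ K` on `G ⧸ K` (the fixed cosets of `γ` are the `xK` with `x⁻¹ γ x ∈ K`). [cite: Serre1980Trees, Ch. I §5.1 and Ch. II §1.3] -/
theorem smul_mk_eq_mk_iff_conj_mem {G : Type*} [Group G] (K : Subgroup G) (γ x : G) :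
    γ • (QuotientGroup.mk x : G ⧸ K) = QuotientGroup.mk x ↔ x⁻¹ * γ * x ∈ K := by
  rw [MulAction.Quotient.smul_mk, QuotientGroup.eq, ← K.inv_mem_iff, smul_eq_mul]
  have h : ((γ * x)⁻¹ * x)⁻¹ = x⁻¹ * γ * x := by group
  rw [h]

include hγ hd in
/-- **`|φ(γ)ᵢᵢ| ≠ 1` ⇒ `γ` FIXES NO COSET of the compact subgroup `K`**: `MulAction.fixedBy (G ⧸ K) γ = ∅` (Serre: a hyperbolic element fixes no vertex and no edge).
[cite: Serre1980Trees, Ch. II §1.3] [cite: Kottwitz1988, §2] -/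
theorem fixedBy_quotient_eq_empty_of_valuation_apply_ne_one (hφ : IsClosedEmbedding φ) (K : Subgroup G) (hKc : IsCompact (K : Set G)) {i : Fin N}
    (hγi : valuation (w.adicCompletion E) (((φ γ : GL (Fin N) (w.adicCompletion E)) : Matrix (Fin N) (Fin N) (w.adicCompletion E)) i i) ≠ 1) :
    MulAction.fixedBy (G ⧸ K) γ = ∅ := by
  refine Set.eq_empty_iff_forall_notMem.2 fun q hq => ?_
  induction q using QuotientGroup.induction_on with
  | H x =>
    rw [MulAction.mem_fixedBy, smul_mk_eq_mk_iff_conj_mem] at hq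
    exact forall_conj_notMem_of_valuation_apply_ne_one w φ hγ hd hφ K hKc hγi x hq

include hγ hd in
/-- **… so EVERY PER-PERIOD COUNT VANISHES**: for any setoid `R` on `G ⧸ K` (e.g. `MulAction.orbitRel (Subgroup.zpowers τ) (G ⧸ K)` of ★ p843359
`classOrbitalIntegral_indicator_eq_mul_natCard_quotient_zpowers`), `Nat.card (Quotient (R.comap (Subtype.val : fixedBy (G ⧸ K) γ → G ⧸ K))) = 0` — the HYPERBOLIC rows of
Kottwitz's relation (N) read `0 + 0 − 0 = 0` for the three facet stabilisers alike. [cite: Kottwitz1988, §2 Theorem 2] [cite: Serre1980Trees, Ch. II §1.3] -/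
theorem natCard_quotient_fixedBy_eq_zero_of_valuation_apply_ne_one (hφ : IsClosedEmbedding φ) (K : Subgroup G) (hKc : IsCompact (K : Set G)) {i : Fin N}
    (hγi : valuation (w.adicCompletion E) (((φ γ : GL (Fin N) (w.adicCompletion E)) : Matrix (Fin N) (Fin N) (w.adicCompletion E)) i i) ≠ 1)
    (R : Setoid (G ⧸ K)) :
    Nat.card (Quotient (R.comap (Subtype.val : MulAction.fixedBy (G ⧸ K) γ → G ⧸ K))) = 0 := by
  haveI : IsEmpty (MulAction.fixedBy (G ⧸ K) γ) := by
    rw [fixedBy_quotient_eq_empty_of_valuation_apply_ne_one w φ hγ hd hφ K hKc hγi]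
    exact Set.isEmpty_coe_sort.mpr rfl
  haveI : IsEmpty (Quotient (R.comap (Subtype.val : MulAction.fixedBy (G ⧸ K) γ → G ⧸ K))) :=
    ⟨fun q => Quotient.inductionOn' q fun a => isEmptyElim a⟩
  exact Nat.card_of_isEmpty

end Literature.NumberTheory.Automorphic
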